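import Summits.ValiantsHypothesis.ValiantsHypothesis.Theorems.KPlusLogSqLawTropicalGradedWalkChain
import Summits.ValiantsHypothesis.ValiantsHypothesis.Theorems.KPlusLogSqLawTropicalGradedWalkChainTwoDefs
import Summits.ValiantsHypothesis.ValiantsHypothesis.Theorems.KPlusLogSqLawTropicalGradedWalkSignsOne
import Summits.ValiantsHypothesis.ValiantsHypothesis.Theorems.KPlusLogSqLawTropicalGradedWalkDomXOneGlue4

/-!
# Route «KPlusLogSqLaw» — GRW-lite (all-`m` `K = 4` family): the full chain over the phases `1 ≤ w ≤ m − 1` and the count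

HONEST FRAMING.  Helper file of the chain `--supports` the crux `Summit.ValiantsHypothesis.ValiantsHypothesis.Theses.KPlusLogSqLaw.TropicalB`
(item `stmt-ValiantsHypothesis-19771`, route `KPlusLogSqLaw`; cell `pub-symmetroid`, seat val-sym-trop-p3 g15, 2026-08-29), on top of
`…GradedWalkChain` (reduced chain, helper inequalities), `…ChainTwoDefs`, the dominance theorems `isDominant_D/T/X/X1` and the sign files.
CENSUS-SIDE (lower bound) theorem about the tropical row `(m, 4)`; it says nothing about `TropicalB` inside its window, `WeakLifting`,
the doors, `MatrixDescartes` or `VP ≠ VNP`, and nothing about the cell's `K = 4` fork (the family is quadratic).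

CONTENT.  With the `u = 1` excursion pair now kernel-dominant (`isDominant_X1`), the chain runs through ALL `3w` states of every phase
`1 ≤ w ≤ n = m − 1` of the GRW-lite design: `offP2 (n+1) = 3n(n+1)/2` sign-alternating unique optima, whence

* `offP2_sub_one_le_of_tropRootLawAt_four : TropRootLawAt (n+1) 4 B → offP2 (n+1) − 1 ≤ B`,
* `grw2_le_of_tropRootLawAt_four : TropRootLawAt m 4 B → (3m² − 3m)/2 − 1 ≤ B` for every `m ≥ 1`.

(The located full GRW-lite chain has `2m² + 2` terms; the remaining `(m² + 3m + 6)/2` are phase `0`'s single state and phase `m`.)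
-/

set_option linter.dupNamespace false
set_option autoImplicit false

namespace Summit.ValiantsHypothesis.ValiantsHypothesis.Theorems.LacunarySymmetroidMatrixDescartes.TropicalCensus

namespace GradedWalk

open Summit.ValiantsHypothesis.ValiantsHypothesis.Theorems.MatrixDescartes.Negative

variable (n : ℕ)

/-! ### the full chain: invariant and rank -/

/-- the chain starts at `D(1,0,0)`. -/
theorem seqR2_zero : seqR2 0 = (1, 0, 0) := rfl

/-- the chain is the iteration of `nxt2`. -/
theorem seqR2_succ (k : ℕ) : seqR2 (k + 1) = nxt2 (seqR2 k) := by
  unfold seqR2; rw [Function.iterate_succ_apply']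

/-- `offP2 (w+1) = offP2 w + 3w`. -/
theorem offP2_succ (w : ℕ) : offP2 (w + 1) = offP2 w + 3 * w := rfl

/-- `nxt2` preserves the invariant. -/
theorem validR2_nxt2 {s : ℕ × ℕ × ℕ} (h : ValidR2 s) : ValidR2 (nxt2 s) := by
  obtain ⟨w, u, t⟩ := s
  simp only [ValidR2, nxt2] at *
  split_ifs <;> (try dsimp only at *) <;> omega

/-- every state of the chain satisfies the invariant. -/
theorem validR2_seqR2 (k : ℕ) : ValidR2 (seqR2 k) := by
  induction k with
  | zero => rw [seqR2_zero]; simp [ValidR2]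
  | succ k ih => rw [seqR2_succ]; exact validR2_nxt2 ih

/-- `nxt2` raises the rank by one. -/
theorem idxR2_nxt2 {s : ℕ × ℕ × ℕ} (h : ValidR2 s) : idxR2 (nxt2 s) = idxR2 s + 1 := by
  obtain ⟨w, u, t⟩ := s
  simp only [ValidR2] at h
  have hoff : offP2 (w + 1) = offP2 w + 3 * w := offP2_succ w
  simp only [nxt2, idxR2, posR2]
  split_ifs <;> (try dsimp only at *) <;> (try rw [hoff]) <;> omega

/-- the `k`-th state has rank `k`. -/
theorem idxR2_seqR2 (k : ℕ) : idxR2 (seqR2 k) = k := by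
  induction k with
  | zero => rw [seqR2_zero]; simp [idxR2, offP2, posR2]
  | succ k ih => rw [seqR2_succ, idxR2_nxt2 (validR2_seqR2 k), ih]

/-- `offP2` is monotone. -/
theorem offP2_mono : Monotone offP2 := by
  refine monotone_nat_of_le_succ fun w => ?_
  rw [offP2_succ]; omega

/-- the `k`-th state lies in a phase `≤ n` as long as `k < offP2 (n+1)`. -/
theorem seqR2_phase_le (k : ℕ) (hk : k < offP2 (n + 1)) : (seqR2 k).1 ≤ n := by
  by_contra hcon
  have h1 : offP2 (n + 1) ≤ offP2 (seqR2 k).1 := offP2_mono (by omega)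
  have h2 : offP2 (seqR2 k).1 ≤ idxR2 (seqR2 k) := Nat.le_add_right _ _
  rw [idxR2_seqR2] at h2
  omega

/-! ### slopes increase -/

/-- the slope increases along the full chain. -/
theorem theta_lt_nxt2 {s : ℕ × ℕ × ℕ} (h : ValidR2 s) (hw : s.1 ≤ n) :
    theta n s.1 s.2.1 s.2.2 < theta n (nxt2 s).1 (nxt2 s).2.1 (nxt2 s).2.2 := by
  obtain ⟨w, u, t⟩ := s
  simp only [ValidR2] at h
  simp only at hw
  obtain ⟨hw1, hD | hX | hT⟩ := h
  · obtain ⟨huw, ht⟩ := hD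
    subst ht
    simp only [nxt2, if_pos huw, if_true]
    by_cases hu0 : u = 0
    · subst hu0; simp only [if_true]
      by_cases h2 : 1 < w
      · rw [if_pos h2]; simp only
        rw [theta_of_le n hw, theta_of_le n hw, if_pos huw, if_pos h2]
        have := MM_pos n; push_cast; nlinarith
      · rw [if_neg h2]; simp only
        rw [theta_of_le n hw, theta_of_le n hw, if_pos huw, if_neg (lt_irrefl w)]
        have := MM_pos n
        have hwz : (1 : ℤ) ≤ w := by exact_mod_cast hw1
        push_cast; nlinarith
    · rw [if_neg hu0]; simp only
      rw [theta_of_le n hw, theta_of_le n hw, if_pos huw, if_pos huw]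
      push_cast; linarith
  · obtain ⟨hu1, huw, ht⟩ := hX
    subst ht
    simp only [nxt2, if_pos huw, one_ne_zero, if_false]
    by_cases h2 : u + 1 < w
    · rw [if_pos h2]; simp only
      rw [theta_of_le n hw, theta_of_le n hw, if_pos huw, if_pos h2]
      have := MM_gt_four n; push_cast; nlinarith
    · rw [if_neg h2]; simp only
      rw [theta_of_le n hw, theta_of_le n hw, if_pos huw, if_neg (lt_irrefl w)]
      have := MM_gt_four n
      have hwu : (w : ℤ) = u + 1 := by exact_mod_cast (show w = u + 1 by omega)
      push_cast; nlinarith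
  · obtain ⟨huw, htw⟩ := hT
    subst huw
    simp only [nxt2, lt_irrefl, if_false]
    by_cases h2 : t < u
    · rw [if_pos h2]; simp only
      rw [theta_of_le n hw, theta_of_le n hw, if_neg (lt_irrefl u), if_neg (lt_irrefl u)]
      push_cast; linarith
    · rw [if_neg h2]; simp only
      rw [theta_of_le n hw, theta_phase_start, if_neg (lt_irrefl u)]
      have hb := boundary_gap n hw
      have htu : (t : ℤ) = u := by exact_mod_cast (show t = u by omega)
      push_cast; nlinarith

/-! ### dominance and sign alternation along the chain -/

/-- every state of the full chain in a phase `≤ n` is the unique optimum at its slope. -/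
theorem isDominant_validR2 {s : ℕ × ℕ × ℕ} (h : ValidR2 s) (hw : s.1 ≤ n) :
    IsDominant (dd n) (vv n) (ee n) (theta n s.1 s.2.1 s.2.2) (cterm n s.1 s.2.1 s.2.2) := by
  obtain ⟨w, u, t⟩ := s
  simp only [ValidR2] at h
  simp only at hw ⊢
  obtain ⟨hw1, ⟨huw, ht⟩ | ⟨hu1, huw, ht⟩ | ⟨huw, htw⟩⟩ := h
  · subst ht; exact isDominant_D n w u huw hw
  · subst ht
    rcases Nat.lt_or_ge u 2 with hu2 | hu2
    · have hu : u = 1 := by omega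
      subst hu; exact isDominant_X1 n w (by omega) hw
    · exact isDominant_X n w u hu2 huw hw
  · subst huw; exact isDominant_T n u t htw hw hw1

/-- consecutive states of the full chain have terms of opposite signs. -/
theorem termSign_nxt2 {s : ℕ × ℕ × ℕ} (h : ValidR2 s) (hw : (nxt2 s).1 ≤ n) :
    termSign (ee n) (cterm n s.1 s.2.1 s.2.2) * termSign (ee n) (cterm n (nxt2 s).1 (nxt2 s).2.1 (nxt2 s).2.2) < 0 := by
  obtain ⟨w, u, t⟩ := s
  simp only [ValidR2] at h
  obtain ⟨hw1, hD | hX | hT⟩ := h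
  · obtain ⟨huw, ht⟩ := hD
    subst ht
    simp only [nxt2, if_pos huw, if_true] at hw ⊢
    by_cases hu0 : u = 0
    · subst hu0; simp only [if_true] at hw ⊢
      by_cases h2 : 1 < w
      · rw [if_pos h2] at hw ⊢; simp only at hw ⊢
        exact termSign_D_zero_one n w h2 hw
      · rw [if_neg h2] at hw ⊢; simp only at hw ⊢
        exact termSign_D_zero_T n w hw1 hw
    · rw [if_neg hu0] at hw ⊢; simp only at hw ⊢
      rcases Nat.lt_or_ge u 2 with hu2 | hu2
      · have hu : u = 1 := by omega
        subst hu; exact termSign_D_X_one n w (by omega) hw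
      · exact termSign_D_X n w u hu2 huw hw
  · obtain ⟨hu1, huw, ht⟩ := hX
    subst ht
    simp only [nxt2, if_pos huw, one_ne_zero, if_false] at hw ⊢
    by_cases h2 : u + 1 < w
    · rw [if_pos h2] at hw ⊢; simp only at hw ⊢
      rcases Nat.lt_or_ge u 2 with hu2 | hu2
      · have hu : u = 1 := by omega
        subst hu; exact termSign_X_D_one n w (by omega) hw
      · exact termSign_X_D n w u hu2 h2 hw
    · rw [if_neg h2] at hw ⊢; simp only at hw ⊢
      rcases Nat.lt_or_ge u 2 with hu2 | hu2
      · have hu : u = 1 := by omega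
        subst hu
        have hw2 : w = 2 := by omega
        subst hw2
        exact termSign_X_T_one n hw
      · have hu : u = w - 1 := by omega
        subst hu
        exact termSign_X_T n w (by omega) hw
  · obtain ⟨huw, htw⟩ := hT
    subst huw
    simp only [nxt2, lt_irrefl, if_false] at hw ⊢
    by_cases h2 : t < u
    · rw [if_pos h2] at hw ⊢; simp only at hw ⊢
      exact termSign_T_step n u t h2 hw
    · rw [if_neg h2] at hw ⊢; simp only at hw ⊢
      have ht : t = u := by omega
      subst ht
      exact termSign_boundary n t hw1 hw

/-! ### the count -/

/-- **the tropical row `(m, 4)`, `m = n + 1`, is at least `offP2 (n+1) − 1`** (the full chain over the phases `w < m` has `offP2 (n+1)` terms). -/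
theorem offP2_sub_one_le_of_tropRootLawAt_four (B : ℕ) (h : TropRootLawAt (n + 1) 4 B) : offP2 (n + 1) - 1 ≤ B := by
  rcases Nat.eq_zero_or_pos (offP2 (n + 1)) with h0 | hpos
  · rw [h0]; exact Nat.zero_le _
  set N := offP2 (n + 1) - 1 with hN
  have hphase : ∀ k : ℕ, k ≤ N → (seqR2 k).1 ≤ n := fun k hk => seqR2_phase_le n k (by omega)
  exact h (dd n) (vv n) (ee n) N (fun k => theta n (seqR2 k).1 (seqR2 k).2.1 (seqR2 k).2.2)
    (fun k => cterm n (seqR2 k).1 (seqR2 k).2.1 (seqR2 k).2.2)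
    (fun i j l => by have := ee_natAbs_lt_two n i j l; omega)
    (by
      refine Fin.strictMono_iff_lt_succ.mpr fun k => ?_
      simp only [Fin.val_castSucc, Fin.val_succ]
      rw [seqR2_succ]
      exact theta_lt_nxt2 n (validR2_seqR2 k) (hphase k (by omega)))
    (fun k => isDominant_validR2 n (validR2_seqR2 k) (hphase k (by omega)))
    (fun k => by
      simp only [Fin.val_castSucc, Fin.val_succ]
      rw [seqR2_succ]
      exact termSign_nxt2 n (validR2_seqR2 k) (by rw [← seqR2_succ]; exact hphase (k + 1) (by omega)))

/-- closed form of the length: `2 · offP2 (n+1) = 3n(n+1)`. -/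
theorem two_mul_offP2 (n : ℕ) : 2 * offP2 (n + 1) = 3 * n ^ 2 + 3 * n := by
  induction n with
  | zero => simp [offP2]
  | succ k ih =>
    rw [offP2_succ]
    have h3 : (k + 1) ^ 2 = k ^ 2 + 2 * k + 1 := by ring
    rw [h3]
    generalize k ^ 2 = q at *
    omega

end GradedWalk

/-- **An all-`m` floor of leading coefficient `3/2` for the `K = 4` tropical census row, second cut:** every bound `B` of the tropical
row `(m, 4)`, `m ≥ 1`, satisfies `(3m² − 3m)/2 − 1 ≤ B` — the full GRW-lite chain over the phases `w < m`
has `3m(m−1)/2` sign-alternating unique optima.  Census side only; nothing here bears on `TropicalB` in its window or on the cell's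
`K = 4` fork. -/
theorem grw2_le_of_tropRootLawAt_four (m B : ℕ) (hm : 1 ≤ m) (h : TropRootLawAt m 4 B) : (3 * m ^ 2 - 3 * m) / 2 - 1 ≤ B := by
  obtain ⟨n, rfl⟩ : ∃ n, m = n + 1 := ⟨m - 1, by omega⟩
  have h1 := GradedWalk.offP2_sub_one_le_of_tropRootLawAt_four n B h
  have h2 := GradedWalk.two_mul_offP2 n
  have h3 : (n + 1) ^ 2 = n ^ 2 + 2 * n + 1 := by ring
  have h4 : n ≤ n ^ 2 := by nlinarith
  rw [h3]
  generalize n ^ 2 = q at *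
  omega

end Summit.ValiantsHypothesis.ValiantsHypothesis.Theorems.LacunarySymmetroidMatrixDescartes.TropicalCensus
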